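import Literature.Geometry.Kaehler.HodgeStarBasisProofs
import Mathlib.Algebra.Order.Chebyshev
import HarnessLib

/-!
# The inner product of `k`-forms in a frame: comparison with the operator norm and frame perturbation

Layer `Literature/Geometry/Kaehler`, companion of `HodgeStar.lean` / `HodgeStarBasisProofs.lean`
(the induced inner product `alternatingFormInner V n k` on `k`-covectors of an `n`-dimensional real
inner product space; F. W. Warner, *Foundations of Differentiable Manifolds and Lie Groups*,
GTM 94 (1983), Ch. 2 Ex. 13: `⟪α, β⟫ = ∑_{|s|=k} α(b_s) β(b_s)` in any orthonormal basis). This file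
records the elementary ESTIMATES behind the comparison of the `L²` metrics of two nearby Riemannian
structures (consumer: the semicontinuity of Hodge numbers in families,
`AlgebraicGeometry/Motives/FiberNetExistenceProofs`, Voisin I Prop. 9.20), all PROVED:

* `alternatingFormInner_eq_inv_factorial_mul_sum` — `⟪α, β⟫ = (k!)⁻¹ ∑_{i : Fin k → Fin n} α(b ∘ i) β(b ∘ i)`,
  the sum over ALL `k`-tuples of basis vectors (Warner's formula combined with the tree's
  `HodgeStarAux.sum_apply_comp_mul_eq_factorial_mul`);
* `sum_sq_apply_le`, `alternatingFormInner_self_le` — `∑ᵢ α(b∘i)² ≤ nᵏ ‖α‖²`, whence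
  `⟪α, α⟫ ≤ (nᵏ/k!) ‖α‖²` (operator norm of the continuous alternating map `α`);
* `norm_sq_le_mul_alternatingFormInner_self` — conversely `‖α‖² ≤ nᵏ k! ⟪α, α⟫` (expand the
  arguments in the orthonormal basis, Cauchy–Schwarz over the `nᵏ` tuples): **the operator norm and
  the Euclidean norm of `k`-covectors are equivalent with constants depending only on `n`, `k`**;
* `abs_sum_apply_mul_apply_sub_le` — **frame perturbation**: for frames `f`, `f'` of norms `≤ R`
  (`R ≥ 1`) with `‖f'ⱼ - fⱼ‖ ≤ d`,
  `|∑ᵢ α(f'∘i) β(f'∘i) - ∑ᵢ α(f∘i) β(f∘i)| ≤ nᵏ · 2k R²ᵏ d ‖α‖ ‖β‖` (Mathlib's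
  `ContinuousMultilinearMap.norm_image_sub_le`);
* `abs_volumeForm_sub_one_le` — `|vol_o(f') - 1| ≤ n 2ⁿ d` for a frame `d`-close (`d ≤ 1`) to a
  positively oriented orthonormal basis;
* `abs_frameSum_mul_volumeForm_sub_alternatingFormInner_le` — the **combination** consumed by the
  transport of `L²` products: for `f'` within `d ≤ 1` of a positively oriented orthonormal basis
  `b`, `|(k!)⁻¹ (∑ᵢ α(f'∘i) β(f'∘i)) · vol_o(f') - ⟪α, β⟫| ≤ n²ᵏ 4ⁿ⁺ᵏ (n + k) · d · (⟪α, α⟫ + ⟪β, β⟫)`.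

No definitions, no named facts (D-0026). [folklore]

## References

* F. W. Warner, *Foundations of Differentiable Manifolds and Lie Groups*, GTM 94 (1983), Ch. 2
  Ex. 13 (1), pp. 79–80. [WarnerGTM94]
-/

noncomputable section

open Module ContinuousAlternatingMap Finset
open scoped Nat InnerProductSpace RealInnerProductSpace

namespace Literature.Geometry.Kaehler

open HodgeStarAux

variable {V : Type*} [NormedAddCommGroup V] [InnerProductSpace ℝ V] [FiniteDimensional ℝ V]
  {n : ℕ} [Fact (finrank ℝ V = n)] {k : ℕ}

/-! ### The inner product as a sum over all `k`-tuples -/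

/-- **`⟪α, β⟫ = (k!)⁻¹ ∑_{i : Fin k → Fin n} α(b ∘ i) β(b ∘ i)`** for every orthonormal basis `b`
(Warner's `∑_{|s|=k} α(b_s) β(b_s)`, `alternatingFormInner_eq_sum_holds`, rewritten over all
`k`-tuples: non-injective tuples do not contribute and each increasing multi-index is hit `k!` times,
`HodgeStarAux.sum_apply_comp_mul_eq_factorial_mul`). [cite: WarnerGTM94, Ch. 2 Ex. 13 (1)] -/
theorem alternatingFormInner_eq_inv_factorial_mul_sum (b : OrthonormalBasis (Fin n) ℝ V)
    (α β : V [⋀^Fin k]→L[ℝ] ℝ) :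
    alternatingFormInner V n k α β = ((k ! : ℝ))⁻¹ * ∑ i : Fin k → Fin n, α (b ∘ i) * β (b ∘ i) := by
  rw [alternatingFormInner_eq_sum_holds b k α β]
  have h := sum_apply_comp_mul_eq_factorial_mul α.toAlternatingMap β.toAlternatingMap b
  simp only [coe_toAlternatingMap] at h
  rw [h, ← mul_assoc, inv_mul_cancel₀ (by positivity), one_mul]

omit [FiniteDimensional ℝ V] [Fact (finrank ℝ V = n)] in
/-- Each term of the frame sum of an orthonormal basis is bounded by the operator norm:
`|α(b ∘ i)| ≤ ‖α‖`. [folklore] -/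
theorem abs_apply_orthonormalBasis_comp_le (b : OrthonormalBasis (Fin n) ℝ V) (α : V [⋀^Fin k]→L[ℝ] ℝ)
    (i : Fin k → Fin n) : |α (b ∘ i)| ≤ ‖α‖ := by
  have h := α.le_opNorm (b ∘ i)
  simp only [Function.comp_apply, b.norm_eq_one, prod_const_one, mul_one, Real.norm_eq_abs] at h
  exact h

omit [FiniteDimensional ℝ V] [Fact (finrank ℝ V = n)] in
/-- `∑_{i : Fin k → Fin n} α(b ∘ i)² ≤ nᵏ ‖α‖²` for an orthonormal basis `b`. [folklore] -/
theorem sum_sq_apply_le (b : OrthonormalBasis (Fin n) ℝ V) (α : V [⋀^Fin k]→L[ℝ] ℝ) :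
    ∑ i : Fin k → Fin n, α (b ∘ i) ^ 2 ≤ (n : ℝ) ^ k * ‖α‖ ^ 2 := by
  calc ∑ i : Fin k → Fin n, α (b ∘ i) ^ 2 ≤ ∑ _i : Fin k → Fin n, ‖α‖ ^ 2 := by
        refine sum_le_sum fun i _ ↦ ?_
        have h := abs_apply_orthonormalBasis_comp_le b α i
        rw [← sq_abs]
        exact pow_le_pow_left₀ (abs_nonneg _) h 2
    _ = (n : ℝ) ^ k * ‖α‖ ^ 2 := by
        simp only [sum_const, card_univ, Fintype.card_fun, Fintype.card_fin, nsmul_eq_mul]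
        push_cast
        ring

/-- **`⟪α, α⟫ ≤ (nᵏ / k!) ‖α‖²`**: the Euclidean norm of a `k`-covector is controlled by its
operator norm. [folklore] -/
theorem alternatingFormInner_self_le (α : V [⋀^Fin k]→L[ℝ] ℝ) :
    alternatingFormInner V n k α α ≤ ((k ! : ℝ))⁻¹ * (n : ℝ) ^ k * ‖α‖ ^ 2 := by
  set b := stdOrthonormalBasisFin V n
  rw [alternatingFormInner_eq_inv_factorial_mul_sum b, mul_assoc]
  refine mul_le_mul_of_nonneg_left ?_ (by positivity)
  simpa only [pow_two] using sum_sq_apply_le b α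

omit [FiniteDimensional ℝ V] [Fact (finrank ℝ V = n)] in
/-- **Expansion of a `k`-covector on arbitrary arguments in an orthonormal basis**:
`α(v) = ∑_{i : Fin k → Fin n} (∏ₗ ⟪b (i l), v l⟫) α(b ∘ i)`. [folklore] -/
theorem apply_eq_sum_prod_inner_mul (b : OrthonormalBasis (Fin n) ℝ V) (α : V [⋀^Fin k]→L[ℝ] ℝ)
    (v : Fin k → V) :
    α v = ∑ i : Fin k → Fin n, (∏ l, ⟪b (i l), v l⟫) * α (b ∘ i) := by
  set g : MultilinearMap ℝ (fun _ : Fin k ↦ V) ℝ := α.toContinuousMultilinearMap.toMultilinearMap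
  have hg : ∀ w, g w = α w := fun w ↦ rfl
  have hv : v = fun l ↦ ∑ j, ⟪b j, v l⟫ • b j := funext fun l ↦ (b.sum_repr' (v l)).symm
  have h1 : α v = g (fun l ↦ ∑ j, ⟪b j, v l⟫ • b j) := by rw [hg, ← hv]
  rw [h1, g.map_sum fun l j ↦ ⟪b j, v l⟫ • b j]
  refine sum_congr rfl fun i _ ↦ ?_
  rw [g.map_smul_univ, smul_eq_mul, hg]
  rfl

/-- **`‖α‖² ≤ nᵏ k! ⟪α, α⟫`**: the operator norm of a `k`-covector is controlled by its Euclidean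
norm (expand the arguments in an orthonormal basis and apply Cauchy–Schwarz to the `nᵏ` terms).
Together with `alternatingFormInner_self_le`: the two norms are equivalent with constants depending
only on `n` and `k`. [folklore] -/
theorem norm_sq_le_mul_alternatingFormInner_self (α : V [⋀^Fin k]→L[ℝ] ℝ) :
    ‖α‖ ^ 2 ≤ (n : ℝ) ^ k * (k ! : ℝ) * alternatingFormInner V n k α α := by
  set b := stdOrthonormalBasisFin V n
  set S : ℝ := ∑ i : Fin k → Fin n, α (b ∘ i) ^ 2 with hS
  have hS0 : 0 ≤ S := sum_nonneg fun i _ ↦ sq_nonneg _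
  have hinner : alternatingFormInner V n k α α = ((k ! : ℝ))⁻¹ * S := by
    rw [alternatingFormInner_eq_inv_factorial_mul_sum b]; simp only [hS, pow_two]
  -- `‖α‖ ≤ √(nᵏ S)`
  have hbound : ‖α‖ ≤ Real.sqrt ((n : ℝ) ^ k * S) := by
    refine α.opNorm_le_bound (Real.sqrt_nonneg _) fun v ↦ ?_
    rw [apply_eq_sum_prod_inner_mul b α v, Real.norm_eq_abs]
    have hprod : ∀ i : Fin k → Fin n, |∏ l, ⟪b (i l), v l⟫| ≤ ∏ l, ‖v l‖ := by
      intro i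
      rw [abs_prod]
      exact prod_le_prod (fun l _ ↦ abs_nonneg _) fun l _ ↦ by
        simpa [b.norm_eq_one] using abs_real_inner_le_norm (b (i l)) (v l)
    calc |∑ i : Fin k → Fin n, (∏ l, ⟪b (i l), v l⟫) * α (b ∘ i)|
        ≤ ∑ i : Fin k → Fin n, |(∏ l, ⟪b (i l), v l⟫) * α (b ∘ i)| := abs_sum_le_sum_abs _ _
      _ ≤ ∑ i : Fin k → Fin n, (∏ l, ‖v l‖) * |α (b ∘ i)| := by
          refine sum_le_sum fun i _ ↦ ?_
          rw [abs_mul]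
          exact mul_le_mul_of_nonneg_right (hprod i) (abs_nonneg _)
      _ = (∏ l, ‖v l‖) * ∑ i : Fin k → Fin n, |α (b ∘ i)| := by rw [mul_sum]
      _ ≤ (∏ l, ‖v l‖) * Real.sqrt ((n : ℝ) ^ k * S) := by
          refine mul_le_mul_of_nonneg_left ?_ (prod_nonneg fun l _ ↦ norm_nonneg _)
          refine Real.le_sqrt_of_sq_le ?_
          have h := sq_sum_le_card_mul_sum_sq (s := (univ : Finset (Fin k → Fin n)))
            (f := fun i ↦ |α (b ∘ i)|)
          simp only [card_univ, Fintype.card_fun, Fintype.card_fin, sq_abs] at h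
          push_cast at h
          exact h
      _ = Real.sqrt ((n : ℝ) ^ k * S) * ∏ l, ‖v l‖ := mul_comm _ _
  calc ‖α‖ ^ 2 ≤ (Real.sqrt ((n : ℝ) ^ k * S)) ^ 2 := pow_le_pow_left₀ (norm_nonneg _) hbound 2
    _ = (n : ℝ) ^ k * S := Real.sq_sqrt (by positivity)
    _ = (n : ℝ) ^ k * (k ! : ℝ) * alternatingFormInner V n k α α := by
        rw [hinner, mul_assoc, ← mul_assoc (k ! : ℝ), mul_inv_cancel₀ (by positivity), one_mul]

/-- Product form of the norm comparison: `‖α‖ ‖β‖ ≤ nᵏ k! (⟪α, α⟫ + ⟪β, β⟫) / 2`. [folklore] -/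
theorem norm_mul_norm_le_mul_add_alternatingFormInner (α β : V [⋀^Fin k]→L[ℝ] ℝ) :
    ‖α‖ * ‖β‖ ≤ (n : ℝ) ^ k * (k ! : ℝ) *
      (alternatingFormInner V n k α α + alternatingFormInner V n k β β) / 2 := by
  have ha := norm_sq_le_mul_alternatingFormInner_self (n := n) α
  have hb := norm_sq_le_mul_alternatingFormInner_self (n := n) β
  nlinarith [sq_nonneg (‖α‖ - ‖β‖), norm_nonneg α, norm_nonneg β]

/-! ### Perturbation of the frame -/

omit [InnerProductSpace ℝ V] [FiniteDimensional ℝ V] [Fact (finrank ℝ V = n)] in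
/-- Sup norm of a `k`-tuple extracted from a frame of norms `≤ R`. [folklore] -/
theorem norm_comp_le_of_forall_le {f : Fin n → V} {R : ℝ} (hR : 0 ≤ R) (hf : ∀ j, ‖f j‖ ≤ R)
    (i : Fin k → Fin n) : ‖f ∘ i‖ ≤ R :=
  (pi_norm_le_iff_of_nonneg hR).2 fun l ↦ hf (i l)

omit [FiniteDimensional ℝ V] [Fact (finrank ℝ V = n)] in
/-- **Frame perturbation of the frame sum.** For frames `f`, `f'` with `‖fⱼ‖, ‖f'ⱼ‖ ≤ R`, `R ≥ 1`,
and `‖f'ⱼ - fⱼ‖ ≤ d`: `|∑ᵢ α(f'∘i) β(f'∘i) - ∑ᵢ α(f∘i) β(f∘i)| ≤ nᵏ (2k R²ᵏ d ‖α‖ ‖β‖)`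
(each of the `nᵏ` terms moves by at most `2k R^{2k} d ‖α‖ ‖β‖`,
`ContinuousMultilinearMap.norm_image_sub_le`). [folklore] -/
theorem abs_sum_apply_mul_apply_sub_le (α β : V [⋀^Fin k]→L[ℝ] ℝ) (f f' : Fin n → V) {R d : ℝ}
    (hR : 1 ≤ R) (hd0 : 0 ≤ d) (hf : ∀ j, ‖f j‖ ≤ R) (hf' : ∀ j, ‖f' j‖ ≤ R)
    (hd : ∀ j, ‖f' j - f j‖ ≤ d) :
    |∑ i : Fin k → Fin n, α (f' ∘ i) * β (f' ∘ i) - ∑ i : Fin k → Fin n, α (f ∘ i) * β (f ∘ i)| ≤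
      (n : ℝ) ^ k * (2 * k * R ^ (2 * k) * d * ‖α‖ * ‖β‖) := by
  have hR0 : 0 ≤ R := by linarith
  -- per-term bound
  have hterm : ∀ i : Fin k → Fin n,
      |α (f' ∘ i) * β (f' ∘ i) - α (f ∘ i) * β (f ∘ i)| ≤ 2 * k * R ^ (2 * k) * d * ‖α‖ * ‖β‖ := by
    intro i
    have hfi : ‖f ∘ i‖ ≤ R := norm_comp_le_of_forall_le hR0 hf i
    have hf'i : ‖f' ∘ i‖ ≤ R := norm_comp_le_of_forall_le hR0 hf' i
    have hdi : ‖f' ∘ i - f ∘ i‖ ≤ d := (pi_norm_le_iff_of_nonneg hd0).2 fun l ↦ hd (i l)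
    have hmax : max ‖f' ∘ i‖ ‖f ∘ i‖ ≤ R := max_le hf'i hfi
    have hmaxpow : max ‖f' ∘ i‖ ‖f ∘ i‖ ^ (k - 1) ≤ R ^ k :=
      (pow_le_pow_left₀ (le_max_of_le_left (norm_nonneg _)) hmax _).trans
        (pow_le_pow_right₀ hR (Nat.sub_le k 1))
    -- differences of values
    have hdα : |α (f' ∘ i) - α (f ∘ i)| ≤ ‖α‖ * k * R ^ k * d := by
      have h := α.toContinuousMultilinearMap.norm_image_sub_le (f' ∘ i) (f ∘ i)
      simp only [coe_toContinuousMultilinearMap, Fintype.card_fin, Real.norm_eq_abs,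
        ContinuousAlternatingMap.norm_toContinuousMultilinearMap] at h
      refine h.trans ?_
      have h1 : ‖α‖ * k * max ‖f' ∘ i‖ ‖f ∘ i‖ ^ (k - 1) ≤ ‖α‖ * k * R ^ k :=
        mul_le_mul_of_nonneg_left hmaxpow (by positivity)
      exact mul_le_mul h1 hdi (norm_nonneg _) (by positivity)
    have hdβ : |β (f' ∘ i) - β (f ∘ i)| ≤ ‖β‖ * k * R ^ k * d := by
      have h := β.toContinuousMultilinearMap.norm_image_sub_le (f' ∘ i) (f ∘ i)
      simp only [coe_toContinuousMultilinearMap, Fintype.card_fin, Real.norm_eq_abs,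
        ContinuousAlternatingMap.norm_toContinuousMultilinearMap] at h
      refine h.trans ?_
      have h1 : ‖β‖ * k * max ‖f' ∘ i‖ ‖f ∘ i‖ ^ (k - 1) ≤ ‖β‖ * k * R ^ k :=
        mul_le_mul_of_nonneg_left hmaxpow (by positivity)
      exact mul_le_mul h1 hdi (norm_nonneg _) (by positivity)
    -- values
    have hvβ : |β (f' ∘ i)| ≤ ‖β‖ * R ^ k := by
      simpa [Real.norm_eq_abs] using β.le_opNorm_mul_pow_of_le hf'i
    have hvα : |α (f ∘ i)| ≤ ‖α‖ * R ^ k := by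
      simpa [Real.norm_eq_abs] using α.le_opNorm_mul_pow_of_le hfi
    have hsplit : α (f' ∘ i) * β (f' ∘ i) - α (f ∘ i) * β (f ∘ i) =
        (α (f' ∘ i) - α (f ∘ i)) * β (f' ∘ i) + α (f ∘ i) * (β (f' ∘ i) - β (f ∘ i)) := by ring
    rw [hsplit]
    have hRk : R ^ k * R ^ k = R ^ (2 * k) := by rw [← pow_add]; ring_nf
    calc |(α (f' ∘ i) - α (f ∘ i)) * β (f' ∘ i) + α (f ∘ i) * (β (f' ∘ i) - β (f ∘ i))|
        ≤ |α (f' ∘ i) - α (f ∘ i)| * |β (f' ∘ i)| + |α (f ∘ i)| * |β (f' ∘ i) - β (f ∘ i)| := by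
          rw [← abs_mul, ← abs_mul]; exact abs_add_le _ _
      _ ≤ (‖α‖ * k * R ^ k * d) * (‖β‖ * R ^ k) + (‖α‖ * R ^ k) * (‖β‖ * k * R ^ k * d) :=
          add_le_add (mul_le_mul hdα hvβ (abs_nonneg _) (by positivity))
            (mul_le_mul hvα hdβ (abs_nonneg _) (by positivity))
      _ = 2 * k * R ^ (2 * k) * d * ‖α‖ * ‖β‖ := by rw [← hRk]; ring
  calc |∑ i : Fin k → Fin n, α (f' ∘ i) * β (f' ∘ i) - ∑ i : Fin k → Fin n, α (f ∘ i) * β (f ∘ i)|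
      = |∑ i : Fin k → Fin n, (α (f' ∘ i) * β (f' ∘ i) - α (f ∘ i) * β (f ∘ i))| := by
        rw [sum_sub_distrib]
    _ ≤ ∑ i : Fin k → Fin n, |α (f' ∘ i) * β (f' ∘ i) - α (f ∘ i) * β (f ∘ i)| :=
        abs_sum_le_sum_abs _ _
    _ ≤ ∑ _i : Fin k → Fin n, 2 * k * R ^ (2 * k) * d * ‖α‖ * ‖β‖ := sum_le_sum fun i _ ↦ hterm i
    _ = (n : ℝ) ^ k * (2 * k * R ^ (2 * k) * d * ‖α‖ * ‖β‖) := by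
        simp only [sum_const, card_univ, Fintype.card_fun, Fintype.card_fin, nsmul_eq_mul]
        push_cast
        ring

/-! ### Perturbation of the volume form -/

section Volume

variable (o : Orientation ℝ V (Fin n))

omit [FiniteDimensional ℝ V] in
/-- The operator norm of the volume form is at most `1` (Hadamard, `Orientation.abs_volumeForm_apply_le`).
[folklore] -/
theorem norm_volumeFormL_le_one : ‖o.volumeFormL‖ ≤ 1 :=
  AlternatingMap.mkContinuous_norm_le _ zero_le_one _

omit [FiniteDimensional ℝ V] in
/-- **The volume of a frame close to a positively oriented orthonormal basis is close to `1`**: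
if `‖f'ⱼ - bⱼ‖ ≤ d ≤ 1` for all `j` then `|vol_o(f') - 1| ≤ n 2ⁿ d` (`vol_o(b) = 1` by
`Orientation.volumeForm_robust`, and `ContinuousMultilinearMap.norm_image_sub_le`). [folklore] -/
theorem abs_volumeForm_sub_one_le (b : OrthonormalBasis (Fin n) ℝ V) (hb : b.toBasis.orientation = o)
    (f' : Fin n → V) {d : ℝ} (hd0 : 0 ≤ d) (hd1 : d ≤ 1) (hd : ∀ j, ‖f' j - b j‖ ≤ d) :
    |o.volumeForm f' - 1| ≤ n * 2 ^ n * d := by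
  have hvolb : o.volumeForm b = 1 := by
    rw [o.volumeForm_robust b hb]
    simpa using b.toBasis.det_self
  have hb1 : ∀ j, ‖b j‖ ≤ 2 := fun j ↦ by rw [b.norm_eq_one]; norm_num
  have hf' : ∀ j, ‖f' j‖ ≤ 2 := fun j ↦ by
    have := norm_le_of_mem_closedBall (show f' j ∈ Metric.closedBall (b j) d from
      by rw [Metric.mem_closedBall, dist_eq_norm]; exact hd j)
    rw [b.norm_eq_one] at this; linarith
  have hmax : max ‖f'‖ ‖(⇑b : Fin n → V)‖ ≤ 2 :=
    max_le ((pi_norm_le_iff_of_nonneg zero_le_two).2 hf') ((pi_norm_le_iff_of_nonneg zero_le_two).2 hb1)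
  have hdiff : ‖f' - ⇑b‖ ≤ d := (pi_norm_le_iff_of_nonneg hd0).2 fun j ↦ hd j
  have h := o.volumeFormL.toContinuousMultilinearMap.norm_image_sub_le f' ⇑b
  simp only [coe_toContinuousMultilinearMap, Fintype.card_fin, Real.norm_eq_abs,
    ContinuousAlternatingMap.norm_toContinuousMultilinearMap, Orientation.volumeFormL_apply] at h
  rw [hvolb] at h
  refine h.trans ?_
  have h1 : ‖o.volumeFormL‖ * n * max ‖f'‖ ‖(⇑b : Fin n → V)‖ ^ (n - 1) ≤ 1 * n * 2 ^ n := by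
    have hpow : max ‖f'‖ ‖(⇑b : Fin n → V)‖ ^ (n - 1) ≤ (2 : ℝ) ^ n :=
      (pow_le_pow_left₀ (le_max_of_le_left (norm_nonneg _)) hmax _).trans
        (pow_le_pow_right₀ one_le_two (Nat.sub_le n 1))
    exact mul_le_mul (mul_le_mul_of_nonneg_right (norm_volumeFormL_le_one o) n.cast_nonneg) hpow
      (by positivity) (by positivity)
  calc ‖o.volumeFormL‖ * n * max ‖f'‖ ‖(⇑b : Fin n → V)‖ ^ (n - 1) * ‖f' - ⇑b‖
      ≤ (1 * n * 2 ^ n) * d := mul_le_mul h1 hdiff (norm_nonneg _) (by positivity)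
    _ = n * 2 ^ n * d := by ring

/-- **The combined pointwise estimate** consumed by the transport of `L²` products of forms: for a
positively oriented orthonormal basis `b` and a frame `f'` with `‖f'ⱼ - bⱼ‖ ≤ d ≤ 1`,
`|(k!)⁻¹ (∑ᵢ α(f'∘i) β(f'∘i)) vol_o(f') - ⟪α, β⟫| ≤ n²ᵏ 4ⁿ⁺ᵏ (n + k) d (⟪α, α⟫ + ⟪β, β⟫)` —
the first term is the inner product of the transported covectors times the transported volume
density when `f'` is the pull-back of an orthonormal frame of a nearby metric. [folklore] -/
theorem abs_frameSum_mul_volumeForm_sub_alternatingFormInner_le (b : OrthonormalBasis (Fin n) ℝ V)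
    (hb : b.toBasis.orientation = o) (f' : Fin n → V) {d : ℝ} (hd0 : 0 ≤ d) (hd1 : d ≤ 1)
    (hd : ∀ j, ‖f' j - b j‖ ≤ d) (α β : V [⋀^Fin k]→L[ℝ] ℝ) :
    |((k ! : ℝ))⁻¹ * (∑ i : Fin k → Fin n, α (f' ∘ i) * β (f' ∘ i)) * o.volumeForm f' -
        alternatingFormInner V n k α β| ≤
      (n : ℝ) ^ (2 * k) * 4 ^ (n + k) * (n + k) * d *
        (alternatingFormInner V n k α α + alternatingFormInner V n k β β) := by
  set A : ℝ := ∑ i : Fin k → Fin n, α (f' ∘ i) * β (f' ∘ i) with hA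
  set A₀ : ℝ := ∑ i : Fin k → Fin n, α (b ∘ i) * β (b ∘ i) with hA₀
  set v : ℝ := o.volumeForm f' with hv
  set P : ℝ := alternatingFormInner V n k α α + alternatingFormInner V n k β β with hP
  have hP0 : 0 ≤ P :=
    add_nonneg (alternatingFormInner_self_nonneg k α) (alternatingFormInner_self_nonneg k β)
  have hinner : alternatingFormInner V n k α β = ((k ! : ℝ))⁻¹ * A₀ :=
    alternatingFormInner_eq_inv_factorial_mul_sum b α β
  -- the frames have norms `≤ 2`
  have hb2 : ∀ j, ‖b j‖ ≤ 2 := fun j ↦ by rw [b.norm_eq_one]; norm_num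
  have hf'2 : ∀ j, ‖f' j‖ ≤ 2 := fun j ↦ by
    have h1 := norm_sub_norm_le (f' j) (b j)
    rw [b.norm_eq_one] at h1
    linarith [hd j]
  -- `|A - A₀| ≤ nᵏ · 2k 4ᵏ d ‖α‖‖β‖`
  have hAA : |A - A₀| ≤ (n : ℝ) ^ k * (2 * k * (2 : ℝ) ^ (2 * k) * d * ‖α‖ * ‖β‖) :=
    abs_sum_apply_mul_apply_sub_le α β (⇑b) f' one_le_two hd0 hb2 hf'2 hd
  -- `|v| ≤ 2ⁿ`, `|v - 1| ≤ n 2ⁿ d`, `|A₀| ≤ nᵏ ‖α‖‖β‖`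
  have hvabs : |v| ≤ (2 : ℝ) ^ n := by
    refine (o.abs_volumeForm_apply_le f').trans ?_
    calc ∏ j, ‖f' j‖ ≤ ∏ _j : Fin n, (2 : ℝ) := prod_le_prod (fun j _ ↦ norm_nonneg _) fun j _ ↦ hf'2 j
      _ = 2 ^ n := by simp
  have hv1 : |v - 1| ≤ n * 2 ^ n * d := abs_volumeForm_sub_one_le o b hb f' hd0 hd1 hd
  have hA₀ : |A₀| ≤ (n : ℝ) ^ k * (‖α‖ * ‖β‖) := by
    calc |A₀| ≤ ∑ i : Fin k → Fin n, |α (b ∘ i) * β (b ∘ i)| := abs_sum_le_sum_abs _ _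
      _ ≤ ∑ _i : Fin k → Fin n, ‖α‖ * ‖β‖ := sum_le_sum fun i _ ↦ by
          rw [abs_mul]
          exact mul_le_mul (abs_apply_orthonormalBasis_comp_le b α i)
            (abs_apply_orthonormalBasis_comp_le b β i) (abs_nonneg _) (norm_nonneg _)
      _ = (n : ℝ) ^ k * (‖α‖ * ‖β‖) := by
          simp only [sum_const, card_univ, Fintype.card_fun, Fintype.card_fin, nsmul_eq_mul]; push_cast; ring
  -- `|A v - A₀| ≤ |A - A₀| |v| + |A₀| |v - 1|`
  have hsplit : A * v - A₀ = (A - A₀) * v + A₀ * (v - 1) := by ring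
  have hAv : |A * v - A₀| ≤
      (n : ℝ) ^ k * (2 * k * (2 : ℝ) ^ (2 * k) * d * ‖α‖ * ‖β‖) * 2 ^ n +
        (n : ℝ) ^ k * (‖α‖ * ‖β‖) * (n * 2 ^ n * d) := by
    rw [hsplit]
    calc |(A - A₀) * v + A₀ * (v - 1)| ≤ |A - A₀| * |v| + |A₀| * |v - 1| := by
          rw [← abs_mul, ← abs_mul]; exact abs_add_le _ _
      _ ≤ _ := add_le_add (mul_le_mul hAA hvabs (abs_nonneg _) (by positivity))
          (mul_le_mul hA₀ hv1 (abs_nonneg _) (by positivity))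
  -- norms against inner products
  have hnn : ‖α‖ * ‖β‖ ≤ (n : ℝ) ^ k * (k ! : ℝ) * P / 2 :=
    norm_mul_norm_le_mul_add_alternatingFormInner α β
  have hnn0 : 0 ≤ ‖α‖ * ‖β‖ := by positivity
  -- the main computation
  have hk0 : (0 : ℝ) < k ! := by positivity
  have hLHS : ((k ! : ℝ))⁻¹ * A * v - alternatingFormInner V n k α β = ((k ! : ℝ))⁻¹ * (A * v - A₀) := by
    rw [hinner]; ring
  rw [hLHS, abs_mul, abs_of_pos (inv_pos.2 hk0)]
  -- bound `(k!)⁻¹ |Av - A₀|` by `(k!)⁻¹ · nᵏ 2ⁿ 2^{2k+1} (k+n) d ‖α‖‖β‖` then by the inner products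
  have hn0 : (0 : ℝ) ≤ n := n.cast_nonneg
  have hk0' : (0 : ℝ) ≤ k := k.cast_nonneg
  have h2k : (2 : ℝ) ^ (2 * k) = 4 ^ k := by rw [pow_mul]; norm_num
  have h4 : (4 : ℝ) ^ (n + k) = 2 ^ n * 2 ^ n * 4 ^ k := by
    rw [pow_add, show (4 : ℝ) ^ n = 2 ^ n * 2 ^ n by rw [← mul_pow]; norm_num]
  have hnk : (n : ℝ) ^ (2 * k) = (n : ℝ) ^ k * (n : ℝ) ^ k := by rw [two_mul, pow_add]
  have step1 : |A * v - A₀| ≤ (n : ℝ) ^ k * 2 ^ n * d * (‖α‖ * ‖β‖) * (2 * k * 4 ^ k + n) := by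
    rw [h2k] at hAv; refine hAv.trans (le_of_eq ?_); ring
  have step2 : (n : ℝ) ^ k * 2 ^ n * d * (‖α‖ * ‖β‖) * (2 * k * 4 ^ k + n) ≤
      (n : ℝ) ^ k * 2 ^ n * d * ((n : ℝ) ^ k * (k ! : ℝ) * P / 2) * (2 * k * 4 ^ k + n) := by
    have h0 : 0 ≤ (n : ℝ) ^ k * 2 ^ n * d := by positivity
    have h0' : 0 ≤ 2 * (k : ℝ) * 4 ^ k + n := by positivity
    exact mul_le_mul_of_nonneg_right (mul_le_mul_of_nonneg_left hnn h0) h0'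
  calc ((k ! : ℝ))⁻¹ * |A * v - A₀|
      ≤ ((k ! : ℝ))⁻¹ * ((n : ℝ) ^ k * 2 ^ n * d * ((n : ℝ) ^ k * (k ! : ℝ) * P / 2) * (2 * k * 4 ^ k + n)) :=
        mul_le_mul_of_nonneg_left (step1.trans step2) (by positivity)
    _ = (n : ℝ) ^ (2 * k) * 2 ^ n * (2 * k * 4 ^ k + n) / 2 * d * P := by
        rw [hnk]; field_simp
    _ ≤ (n : ℝ) ^ (2 * k) * 4 ^ (n + k) * (n + k) * d * P := by
        have hd' : 0 ≤ d * P := mul_nonneg hd0 hP0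
        have hbase : (n : ℝ) ^ (2 * k) * 2 ^ n * (2 * k * 4 ^ k + n) / 2 ≤
            (n : ℝ) ^ (2 * k) * 4 ^ (n + k) * (n + k) := by
          rw [h4]
          have h14 : (1 : ℝ) ≤ 4 ^ k := one_le_pow₀ (by norm_num)
          have h12 : (1 : ℝ) ≤ 2 ^ n := one_le_pow₀ (by norm_num)
          have hnn2 : 0 ≤ (n : ℝ) ^ (2 * k) := by positivity
          -- `2ⁿ (2k 4ᵏ + n)/2 ≤ 2ⁿ 2ⁿ 4ᵏ (n + k)`
          have : (2 : ℝ) ^ n * (2 * k * 4 ^ k + n) / 2 ≤ 2 ^ n * 2 ^ n * 4 ^ k * (n + k) := by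
            set X : ℝ := 2 ^ n with hX
            set Y : ℝ := 4 ^ k with hY
            have hX0 : 0 ≤ X := by positivity
            have hY0 : 0 ≤ Y := by positivity
            have hXY : 1 ≤ X * Y := one_le_mul_of_one_le_of_one_le h12 h14
            have p1 : 0 ≤ 2 * k * X * Y * (X - 1) := mul_nonneg (by positivity) (sub_nonneg.2 h12)
            have p2 : 0 ≤ n * X * (2 * (X * Y) - 1) := mul_nonneg (by positivity) (by linarith)
            nlinarith [p1, p2]
          calc (n : ℝ) ^ (2 * k) * 2 ^ n * (2 * k * 4 ^ k + n) / 2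
              = (n : ℝ) ^ (2 * k) * (2 ^ n * (2 * k * 4 ^ k + n) / 2) := by ring
            _ ≤ (n : ℝ) ^ (2 * k) * (2 ^ n * 2 ^ n * 4 ^ k * (n + k)) :=
                mul_le_mul_of_nonneg_left this hnn2
            _ = (n : ℝ) ^ (2 * k) * (2 ^ n * 2 ^ n * 4 ^ k) * (n + k) := by ring
        calc (n : ℝ) ^ (2 * k) * 2 ^ n * (2 * k * 4 ^ k + n) / 2 * d * P
            = ((n : ℝ) ^ (2 * k) * 2 ^ n * (2 * k * 4 ^ k + n) / 2) * (d * P) := by ring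
          _ ≤ ((n : ℝ) ^ (2 * k) * 4 ^ (n + k) * (n + k)) * (d * P) :=
              mul_le_mul_of_nonneg_right hbase hd'
          _ = (n : ℝ) ^ (2 * k) * 4 ^ (n + k) * (n + k) * d * P := by ring

end Volume

end Literature.Geometry.Kaehler
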